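import Mathlib
import HarnessLib
import Summits.KontsevichZagierPeriods.Zeta5Search.CatalanRayQBound
import Summits.KontsevichZagierPeriods.Zeta5Search.Denom.CatalanRayPClosedBound

/-!
# CatalanRayPGrowth — the explicit rational part grows at most like `e^{(b_{j+1}+ε) n}` (fam-denom D9c, part 4)

HONEST FRAMING: systematic search; no irrationality claim unless certified.

fam-denom (pub-zeta5), `families/denom/PCLOSED-API.md` §T-G.  The P-side of input (T-G) of fam-catalan's intrinsic
two-node criterion (`CatalanTwoAdicRayBound.xi_not_ratCast_intrinsic`, staged), in real form and over tree names only: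
from `CatalanRayPClosedBound.abs_rayPClosed_le` and the tree's entropy bound
`CatalanRayQBound.choose_ray_le_exp : C((j+1)n, n) ≤ e^{b_j n}` (`bRate j = (j+1) log(j+1) − j log j`) at `j+1`,
* `abs_rayPClosed_le_exp : |rayPClosed j n| ≤ 48 ((j+2)n+1)³ · n · e^{b_{j+1} n}` for all `j, n ≥ 1`;
* `abs_rayPClosed_eventually_le_exp : ∀ ε > 0, ∃ n₀, ∀ n ≥ n₀, |rayPClosed j n| ≤ e^{(b_{j+1} + ε) n}`.
RATE CAVEAT (recorded for the criterion): the rate here is `b_{j+1}`, not `b_j`.  Termwise bounds on the closed form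
cannot reach `b_j`: the pole coefficients of the γ family (`T = −(n+r)`, `1 ≤ r ≤ n`) have exact size
`≈ C(J+n,n) · e^{δ_j n}` at `r ≈ n log(1+1/j)/2`, `δ_j = log²(1+1/j)/4 > 0`; the true rate `b_j` of the SUM is a
cancellation only visible through the period `Jsym`.  With fam-catalan's `Λ_n ≤ e^{(W(1+2 log 2)+ε)n}` (`W = 2j+1`) the
criterion `b_{j+1} + W(1 + 2 log 2) < 4W log 2`, i.e. `b_{j+1} < W(2 log 2 − 1)`, holds for every `j ≥ 3`
(`j = 3`: 2.5020 < 2.7041; `j = 4`: 2.7034 < 3.4766; `j = 5`: 2.8708 < 4.2492; `j = 8`: 3.2508 < 6.5670).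
-/

namespace Summit.KontsevichZagierPeriods.Zeta5Search.Denom.CatalanRayPClosed

open Finset Filter
open Summit.KontsevichZagierPeriods.Zeta5Search.CatalanTwoAdicSeries (bRate choose_ray_le_exp)

/-- The envelope of `CatalanRayPClosedBound.abs_rayPClosed_le`, cast to `ℝ`. -/
theorem abs_rayPClosed_le_real (j n : ℕ) (hj : 1 ≤ j) (hn : 1 ≤ n) :
    |((rayPClosed j n : ℚ) : ℝ)|
      ≤ 48 * ((((j + 2) * n : ℕ) : ℝ) + 1) ^ 3 * ((n : ℝ) * ((((j + 2) * n).choose n : ℕ) : ℝ)) := by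
  have h := abs_rayPClosed_le j n hj hn
  have h' : (((|rayPClosed j n|) : ℚ) : ℝ)
      ≤ ((48 * (((j + 2) * n : ℕ) + 1 : ℚ) ^ 3 * (n * ((((j + 2) * n).choose n : ℕ) : ℚ)) : ℚ) : ℝ) := by
    exact_mod_cast h
  rw [Rat.cast_abs] at h'
  refine h'.trans (le_of_eq ?_)
  push_cast; ring

/-- **`|rayPClosed j n| ≤ 48 ((j+2)n+1)³ · n · e^{b_{j+1} n}`** for all `j, n ≥ 1` (`b_{j+1} = bRate (j+1)`). -/
theorem abs_rayPClosed_le_exp (j n : ℕ) (hj : 1 ≤ j) (hn : 1 ≤ n) :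
    |((rayPClosed j n : ℚ) : ℝ)|
      ≤ 48 * ((((j + 2) * n : ℕ) : ℝ) + 1) ^ 3 * (n : ℝ) * Real.exp (bRate (j + 1) * n) := by
  have h1 := abs_rayPClosed_le_real j n hj hn
  have h2 : ((((j + 2) * n).choose n : ℕ) : ℝ) ≤ Real.exp (bRate (j + 1) * n) := by
    have := choose_ray_le_exp (j + 1) n (by omega)
    rwa [show j + 1 + 1 = j + 2 by ring] at this
  calc |((rayPClosed j n : ℚ) : ℝ)|
      ≤ 48 * ((((j + 2) * n : ℕ) : ℝ) + 1) ^ 3 * ((n : ℝ) * ((((j + 2) * n).choose n : ℕ) : ℝ)) := h1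
    _ ≤ 48 * ((((j + 2) * n : ℕ) : ℝ) + 1) ^ 3 * ((n : ℝ) * Real.exp (bRate (j + 1) * n)) := by gcongr
    _ = 48 * ((((j + 2) * n : ℕ) : ℝ) + 1) ^ 3 * (n : ℝ) * Real.exp (bRate (j + 1) * n) := by ring

/-- The polynomial prefactor is eventually below `e^{ε x}`. -/
theorem prefactor_eventually_le_exp (j : ℕ) {ε : ℝ} (hε : 0 < ε) :
    ∀ᶠ x : ℝ in atTop, 48 * (((j : ℝ) + 2) * x + 1) ^ 3 * x ≤ Real.exp (ε * x) := by
  have h4 := isLittleO_pow_exp_pos_mul_atTop 4 hε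
  have hc : (0 : ℝ) < 1 / (48 * ((j : ℝ) + 3) ^ 3) := by positivity
  filter_upwards [h4.def hc, eventually_ge_atTop (1 : ℝ)] with x hx hx1
  rw [Real.norm_eq_abs, Real.norm_eq_abs, abs_of_nonneg (by positivity), abs_of_nonneg (Real.exp_pos _).le] at hx
  have hx0 : (0 : ℝ) ≤ x := by linarith
  have hx3 : ((j : ℝ) + 2) * x + 1 ≤ ((j : ℝ) + 3) * x := by nlinarith
  calc 48 * (((j : ℝ) + 2) * x + 1) ^ 3 * x ≤ 48 * (((j : ℝ) + 3) * x) ^ 3 * x := by gcongr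
    _ = (48 * ((j : ℝ) + 3) ^ 3) * x ^ 4 := by ring
    _ ≤ (48 * ((j : ℝ) + 3) ^ 3) * (1 / (48 * ((j : ℝ) + 3) ^ 3) * Real.exp (ε * x)) := by gcongr
    _ = Real.exp (ε * x) := by field_simp

/-- **(T-G), P-side, at rate `b_{j+1}`**: for every `ε > 0`, `|rayPClosed j n| ≤ e^{(b_{j+1} + ε) n}` for all large `n`
(`j ≥ 1`). -/
theorem abs_rayPClosed_eventually_le_exp (j : ℕ) (hj : 1 ≤ j) {ε : ℝ} (hε : 0 < ε) :
    ∃ n₀ : ℕ, ∀ n : ℕ, n₀ ≤ n → |((rayPClosed j n : ℚ) : ℝ)| ≤ Real.exp ((bRate (j + 1) + ε) * n) := by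
  have hev := (tendsto_natCast_atTop_atTop (R := ℝ)).eventually (prefactor_eventually_le_exp j hε)
  obtain ⟨N, hN⟩ := eventually_atTop.mp hev
  refine ⟨max N 1, fun n hn => ?_⟩
  have hn1 : 1 ≤ n := le_trans (le_max_right _ _) hn
  have hq : 48 * (((j : ℝ) + 2) * (n : ℝ) + 1) ^ 3 * (n : ℝ) ≤ Real.exp (ε * n) := hN n (le_trans (le_max_left _ _) hn)
  calc |((rayPClosed j n : ℚ) : ℝ)|
      ≤ 48 * ((((j + 2) * n : ℕ) : ℝ) + 1) ^ 3 * (n : ℝ) * Real.exp (bRate (j + 1) * n) :=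
        abs_rayPClosed_le_exp j n hj hn1
    _ = (48 * (((j : ℝ) + 2) * (n : ℝ) + 1) ^ 3 * (n : ℝ)) * Real.exp (bRate (j + 1) * n) := by push_cast; ring
    _ ≤ Real.exp (ε * n) * Real.exp (bRate (j + 1) * n) := by gcongr
    _ = Real.exp ((bRate (j + 1) + ε) * n) := by rw [← Real.exp_add]; ring_nf

end Summit.KontsevichZagierPeriods.Zeta5Search.Denom.CatalanRayPClosed
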